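import Literature.Topology.FourManifolds.ReducibleTrisectionNotSimplyConnected
import HarnessLib

/-!
# Crux `WeakReductionReduces` (stmt-SmoothPoincare4-17908), line `loop_dichotomy`, stub CORE₅
# (`stub_loopDichotomyFromFiveCore`) — wave 2, structural lemma (H1), part 1 of 2:
# the winding character of a curve compressing in `H₁` and `H₂` detects `k 0`

Helper file (lands `--supports stmt-SmoothPoincare4-17908 --as helper`) for the registered helper
`helper_one_le_kZero_of_doublyCompressing` of the sibling `…StubLoopDichotomyFromFiveCoreAux1.lean`:
for a Gay–Kirby `(g; k)`-trisection `S` of a smooth `4`-manifold `X`, a non-separating curve on the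
central surface `F` bounding compressing discs in `H₁ = Trisection.spineHandlebody S 1` and in
`H₂ = Trisection.spineHandlebody S 2` forces `1 ≤ k 0` (it is a non-separating reducing curve of the
Heegaard splitting `H₁ ∪_F H₂ = ∂X₀ ≅ #^{k 0}(S¹ × S²)`; Aranda–Zupan, §2 p. 6 and p. 21).
**Everything here is proved; no definition and no named fact is introduced.**  This part is the
`π₁`-assembly, one disc fewer and one storey lower than the tree's three-disc theorem
`IsGKTrisection.not_simplyConnectedSpace_of_sideFunctions` (`ReducibleTrisectionNonSeparatingPi1.lean`):

* `one_le_kZero_of_hom_spineHandlebody_succ` (algebra): a homomorphism `w : π₁(F, x) → G` which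
  kills `K₁ = ker (π₁ F → π₁ H₁)` and `K₂ = ker (π₁ F → π₁ H₂)` factors through
  `π₁(F) ⧸ ⟪K₁ ∪ K₂⟫`, free of rank `k (1 + 2) = k 0` by (T2) + (T3)
  (`IsGKTrisection.isFreeOfRank_quotient_pair`, `TrisectionFunctorGKInputs.lean`); a group free of
  rank `0` is trivial, so `w ≠ 1` forces `1 ≤ k 0`.
* `one_le_kZero_of_sideFunctions_two` (the collapse maps): the proof of
  `IsGKTrisection.not_simplyConnectedSpace_of_sideFunctions` for TWO discs `D_q ⊆ H_{q+1}`,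
  `q : Fin 2` — metrise `X`, normal coordinates `K_q = σ_q · infDist(·, D_q)`, one cut-off, the
  collapses `Θ_q = circleCollapse K_q ρ : H_{q+1} → ℝ/ℤ`, the winding character
  `w = wind ∘ (Θ_0|F)⁎` of `π₁(F)`, which kills `K₁`, `K₂` (`ker_inclHomOfSubset_le_ker_windingHom`,
  `ker_windingHom_eq_of_eq_add_coe` / `…_neg_…`) and is `≠ 1` on the crossing arc closed up in the
  path connected `F ∖ δ` (`IsGKTrisection.exists_path_diff_of_isNonSeparating`,
  `windingHom_circleCollapse_ne_one_of_arc_of_path`) — ending in the algebraic lemma instead of (T4).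

## References

* R. Aranda, A. Zupan, *Manifolds with weakly reducible genus-three trisections are standard*,
  arXiv:2503.04607 (2025), §2 (p. 6), p. 21. [ArandaZupan2025]
* A. Abrams, D. Gay, R. Kirby, *Group trisections and smooth 4-manifolds*, Geom. Topol. 22
  (2018), p. 1540 (the map `𝒢`). [AbramsGayKirby2018]
* A. Hatcher, *Algebraic Topology*, CUP (2002), Thm. 1.7 (p. 29), Thm. 1.20. [HatcherAT2002]
-/

-- the registered namespace `Summit.SmoothPoincare4.SmoothPoincare4.Theorems…` repeats a component
set_option linter.dupNamespace false

noncomputable section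

open Set Function Filter Topology Metric
open scoped Manifold ContDiff unitInterval
open Literature.Topology.FourManifolds
open Literature.AlgebraicTopology Literature.AlgebraicTopology.FundamentalGroup
  Literature.AlgebraicTopology.FundamentalGroup.VanKampen

namespace Summit.SmoothPoincare4.SmoothPoincare4.Theorems.WeakReductionReduces.LoopDichotomy

universe u

variable {X : Type u} [TopologicalSpace X] [T2Space X] [SecondCountableTopology X]
  [ChartedSpace (EuclideanSpace ℝ (Fin 4)) X] {g : ℕ} {k : Fin 3 → ℕ} {S : Fin 3 → Set X}

/-! ### Algebra: a character killing `K₁` and `K₂` detects `k 0` -/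

/-- **A non-trivial homomorphism out of `π₁(F)` killing the two kernels `K₁`, `K₂` forces
`1 ≤ k 0`.**  Let `S` be a Gay–Kirby trisection of `X`, `x ∈ F = ⋂ m, S m`, and
`w : π₁(F, x) →* G` a homomorphism whose kernel contains
`K_{q+1} = ker (π₁(F, x) → π₁(H_{q+1}, x))` for `q = 0, 1` (`H_p = Trisection.spineHandlebody S p`).
Then `w` factors through `π₁(F, x) ⧸ ⟪K₁ ∪ K₂⟫ ≅ π₁(∂X₀, x) ≅ F_{k 0}` ((T2) + (T3):
`IsGKTrisection.isFreeOfRank_quotient_pair 1`, with `1 + 2 = 0` in `Fin 3`); if `k 0 = 0` this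
group is trivial and `w = 1`.  Hence `w ≠ 1` gives `1 ≤ k 0`.
[cite: AbramsGayKirby2018, p. 1540 (the map 𝒢)] -/
theorem one_le_kZero_of_hom_spineHandlebody_succ (h : IsGKTrisection X g k S) {x : X}
    (hx : x ∈ ⋂ m, S m) {G : Type*} [Group G]
    (w : FundamentalGroup ↥(⋂ m, S m) ⟨x, hx⟩ →* G)
    (hw : ∀ q : Fin 2, (inclHomOfSubset (iInter_subset_spineHandlebody S q.succ) x hx
      (iInter_subset_spineHandlebody S q.succ hx)).ker ≤ w.ker)
    (hne : w ≠ 1) : 1 ≤ k 0 := by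
  have hfree := h.isFreeOfRank_quotient_pair 1 hx
  have hle : Subgroup.normalClosure
      (((inclHomOfSubset (iInter_subset_inter S 1) x hx (iInter_subset_inter S 1 hx)).ker :
          Set (FundamentalGroup ↥(⋂ m, S m) ⟨x, hx⟩)) ∪
        ((inclHomOfSubset (iInter_subset_inter S (1 + 1)) x hx
          (iInter_subset_inter S (1 + 1) hx)).ker :
          Set (FundamentalGroup ↥(⋂ m, S m) ⟨x, hx⟩))) ≤ w.ker := by
    have e1 : (inclHomOfSubset (iInter_subset_inter S 1) x hx (iInter_subset_inter S 1 hx)).ker ≤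
        w.ker := by
      refine le_trans (le_of_eq ?_) (hw 0)
      exact (ker_inclHomOfSubset_congr (Trisection.spineHandlebody_eq_inter S 1)
        (iInter_subset_spineHandlebody S 1) (iInter_subset_inter S 1) hx).symm
    have e2 : (inclHomOfSubset (iInter_subset_inter S (1 + 1)) x hx
        (iInter_subset_inter S (1 + 1) hx)).ker ≤ w.ker := by
      refine le_trans (le_of_eq ?_) (hw 1)
      exact (ker_inclHomOfSubset_congr (Trisection.spineHandlebody_eq_inter S 2)
        (iInter_subset_spineHandlebody S 2) (iInter_subset_inter S (1 + 1)) hx).symm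
    refine Subgroup.normalClosure_le_normal ?_
    rintro z (h1 | h2)
    exacts [e1 h1, e2 h2]
  by_contra hk
  have hk0 : k ((1 : Fin 3) + 2) = 0 := by
    have e12 : ((1 : Fin 3) + 2) = 0 := rfl
    rw [e12]; omega
  rw [hk0] at hfree
  obtain ⟨e⟩ := hfree
  haveI := e.symm.toEquiv.subsingleton
  have key : ∀ y, QuotientGroup.lift _ w hle y = 1 := fun y => by
    rw [Subsingleton.elim y 1, map_one]
  apply hne
  ext a
  rw [MonoidHom.one_apply, ← QuotientGroup.lift_mk _ hle a]
  exact key _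

/-! ### The collapse maps of two discs -/

omit [TopologicalSpace X] [T2Space X] [SecondCountableTopology X]
  [ChartedSpace (EuclideanSpace ℝ (Fin 4)) X] in
/-- Two different handlebodies `H_{q+1}`, `H_{q'+1}` (`q ≠ q'` in `Fin 2`) of the spine meet only
along the central surface. [folklore] -/
theorem spineHandlebody_succ_inter_subset (S : Fin 3 → Set X) {q q' : Fin 2} (hqq' : q ≠ q') :
    Trisection.spineHandlebody S q.succ ∩ Trisection.spineHandlebody S q'.succ ⊆ ⋂ l, S l :=
  spineHandlebody_inter_spineHandlebody_subset S ((Fin.succ_injective _).ne hqq')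

omit [SecondCountableTopology X] in
/-- **`1 ≤ k 0` from side functions of two compressing discs in `H₁` and `H₂`.**  Let `S` be a
Gay–Kirby trisection of `X` with central surface `F = ⋂ l, S l` and handlebodies
`H_p = Trisection.spineHandlebody S p`, and let `δ` be a non-separating curve on `F`.  Suppose
given, for `q = 0, 1` (disc `q` living in `H_{q+1}`),
* a closed set `D_q ⊆ H_{q+1}` with `D_q ∩ F = δ`;
* an open `O_q ⊇ D_q` and a side function `σ_q = ±1` on `(O_q ∩ H_{q+1}) ∖ D_q`, locally constant
  relative to `H_{q+1}`;
* an open `A ⊇ δ` inside both `O_q` on whose trace `(A ∩ F) ∖ δ` `σ_1` agrees with `σ_0` or with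
  `-σ_0`;
* a crossing arc: a path `α` in `F` inside `A` meeting `δ` at one interior time `s₀`, with
  `σ_0 = -1` before and `σ_0 = +1` after.
Then `1 ≤ k 0`: the winding character of the collapse of `δ` in `F` kills
`K₁`, `K₂` (each collapse extends over the handlebody containing the disc) and is non-trivial on
the arc closed up in `F ∖ δ`; conclude by `one_le_kZero_of_hom_spineHandlebody_succ`.  The proof is
that of `IsGKTrisection.not_simplyConnectedSpace_of_sideFunctions` with two discs.
[cite: ArandaZupan2025, §2 p. 6 (reducing curves, non-separating case)]
[cite: HatcherAT2002, Thm. 1.7 (p. 29)] -/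
theorem one_le_kZero_of_sideFunctions_two (h : IsGKTrisection X g k S)
    {δ : Set X} (hc : Trisection.IsCurve S δ) (hns : Trisection.IsNonSeparating S δ)
    (D : Fin 2 → Set X) (hDc : ∀ q, IsClosed (D q))
    (hDH : ∀ q, D q ⊆ Trisection.spineHandlebody S q.succ)
    (hDF : ∀ q, D q ∩ (⋂ l, S l) = δ)
    (O : Fin 2 → Set X) (hO : ∀ q, IsOpen (O q)) (hDO : ∀ q, D q ⊆ O q)
    (sd : Fin 2 → X → ℝ)
    (hsd : ∀ q, ∀ y ∈ (O q ∩ Trisection.spineHandlebody S q.succ) \ D q,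
      (sd q y = 1 ∨ sd q y = -1) ∧
        ∀ᶠ z in 𝓝[Trisection.spineHandlebody S q.succ] y, sd q z = sd q y)
    (A : Set X) (hA : IsOpen A) (hδA : δ ⊆ A) (hAO : ∀ q, A ⊆ O q)
    (hcomp : ∀ q, (∀ y ∈ (A ∩ ⋂ l, S l) \ δ, sd q y = sd 0 y) ∨
      (∀ y ∈ (A ∩ ⋂ l, S l) \ δ, sd q y = -sd 0 y))
    {a b : ↥(⋂ l, S l)} (α : Path a b) (hαA : ∀ s, (α s : X) ∈ A) (s₀ : I)
    (hs₀ : (0 : ℝ) < s₀ ∧ (s₀ : ℝ) < 1) (hα₀ : (α s₀ : X) ∈ δ)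
    (hαneg : ∀ s, s < s₀ → (α s : X) ∉ δ ∧ sd 0 (α s) = -1)
    (hαpos : ∀ s, s₀ < s → (α s : X) ∉ δ ∧ sd 0 (α s) = 1) :
    1 ≤ k 0 := by
  classical
  -- elementary set relations (`F = ⋂ l, S l`, `H_{q+1} = Trisection.spineHandlebody S q.succ`)
  have hFH : ∀ q : Fin 2, (⋂ l, S l) ⊆ Trisection.spineHandlebody S q.succ := fun q =>
    iInter_subset_spineHandlebody S q.succ
  have hHc : ∀ q : Fin 2, IsClosed (Trisection.spineHandlebody S q.succ) := fun q =>
    h.isClosed_spineHandlebody q.succ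
  have hFc : IsClosed (⋂ l, S l) := h.isCompact_iInter.isClosed
  haveI : CompactSpace X := h.compactSpace
  have hδne : δ.Nonempty := hc.nonempty
  have hδF : δ ⊆ (⋂ l, S l) := hc.1
  have hδD : ∀ q, δ ⊆ D q := fun q y hy => by
    have : y ∈ D q ∩ (⋂ l, S l) := by rw [hDF q]; exact hy
    exact this.1
  have hDne : ∀ q, (D q).Nonempty := fun q => hδne.mono (hδD q)
  have hnotD : ∀ q, ∀ y ∈ (⋂ l, S l), y ∉ δ → y ∉ D q := fun q y hyF hyδ hyD => by
    have : y ∈ D q ∩ (⋂ l, S l) := ⟨hyD, hyF⟩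
    rw [hDF q] at this
    exact hyδ this
  -- a metric
  haveI : TopologicalSpace.MetrizableSpace X := Manifold.metrizableSpace (𝓡 4) X
  letI : MetricSpace X := TopologicalSpace.metrizableSpaceMetric X
  -- the normal coordinates `K_q = σ_q · infDist(·, D_q)`
  set K : Fin 2 → X → ℝ := fun q y => sd q y * infDist y (D q) with hK
  have hK0 : ∀ q, ∀ y ∈ D q, K q y = 0 := fun q y hy => by
    simp only [hK, infDist_zero_of_mem hy, mul_zero]
  have hKabs : ∀ q, ∀ y ∈ O q ∩ Trisection.spineHandlebody S q.succ,
      |K q y| ≤ infDist y (D q) := fun q y hy => by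
    by_cases hyD : y ∈ D q
    · rw [hK0 q y hyD, abs_zero]; exact infDist_nonneg
    · obtain ⟨hv, -⟩ := hsd q y ⟨hy, hyD⟩
      simp only [hK, abs_mul, abs_of_nonneg infDist_nonneg]
      rcases hv with h1 | h1 <;> simp [h1]
  have hDpos : ∀ q, ∀ y, y ∉ D q → 0 < infDist y (D q) := fun q y hyD =>
    ((hDc q).notMem_iff_infDist_pos (hDne q)).1 hyD
  have hKne : ∀ q, ∀ y ∈ O q ∩ Trisection.spineHandlebody S q.succ, y ∉ D q → K q y ≠ 0 :=
      fun q y hy hyD => by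
    obtain ⟨hv, -⟩ := hsd q y ⟨hy, hyD⟩
    have hpos := hDpos q y hyD
    rcases hv with h1 | h1 <;> simp [hK, h1, hpos.ne']
  -- continuity of `K_q` on `O_q ∩ H_{q+1}`, relative to `H_{q+1}`
  have hKcont : ∀ q, ContinuousOn (K q) (O q ∩ (Trisection.spineHandlebody S q.succ)) := by
    intro q y hy
    refine ContinuousWithinAt.mono ?_ inter_subset_right
    by_cases hyD : y ∈ D q
    · -- `K → 0 = K y`
      show Tendsto (K q) (𝓝[(Trisection.spineHandlebody S q.succ)] y) (𝓝 (K q y))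
      rw [hK0 q y hyD, Metric.tendsto_nhds]
      intro ε hε
      have h1 : ∀ᶠ z in 𝓝[Trisection.spineHandlebody S q.succ] y,
          z ∈ O q ∩ Trisection.spineHandlebody S q.succ :=
        Filter.inter_mem (mem_nhdsWithin_of_mem_nhds ((hO q).mem_nhds hy.1)) self_mem_nhdsWithin
      have h2 : ∀ᶠ z in 𝓝[(Trisection.spineHandlebody S q.succ)] y, dist z y < ε :=
        mem_nhdsWithin_of_mem_nhds (Metric.ball_mem_nhds y hε)
      filter_upwards [h1, h2] with z hz1 hz2
      rw [Real.dist_eq, sub_zero]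
      exact lt_of_le_of_lt ((hKabs q z hz1).trans (infDist_le_dist_of_mem hyD)) hz2
    · -- `σ_q` is locally constant and `infDist` is continuous
      obtain ⟨-, hloc⟩ := hsd q y ⟨hy, hyD⟩
      have h1 : ContinuousWithinAt (fun z => sd q y * infDist z (D q))
          (Trisection.spineHandlebody S q.succ) y :=
        (continuous_const.mul (continuous_infDist_pt _)).continuousWithinAt
      refine h1.congr_of_eventuallyEq ?_ ?_
      · filter_upwards [hloc] with z hz
        simp only [hK, hz]
      · simp only [hK]
  -- the open set carrying the cut-off, and the closed set on which it is `1`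
  set Ncut : Set X := {x | ∀ q : Fin 2, x ∈ Trisection.spineHandlebody S q.succ → x ∈ O q} ∩
    {x | x ∈ (⋂ l, S l) → x ∈ A} with hNcut
  have hNo : IsOpen Ncut := by
    have h1 : IsOpen {x : X | ∀ q : Fin 2, x ∈ Trisection.spineHandlebody S q.succ → x ∈ O q} := by
      have : {x : X | ∀ q : Fin 2, x ∈ Trisection.spineHandlebody S q.succ → x ∈ O q} =
          ⋂ q : Fin 2, ((Trisection.spineHandlebody S q.succ)ᶜ ∪ O q) := by
        ext x; simp [imp_iff_not_or]
      rw [this]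
      exact isOpen_iInter_of_finite fun q => (hHc q).isOpen_compl.union (hO q)
    have h2 : IsOpen {x : X | x ∈ (⋂ l, S l) → x ∈ A} := by
      have : {x : X | x ∈ (⋂ l, S l) → x ∈ A} = (⋂ l, S l)ᶜ ∪ A := by
        ext x; simp only [mem_setOf_eq, mem_union, mem_compl_iff, imp_iff_not_or]
      rw [this]
      exact hFc.isOpen_compl.union hA
    exact h1.inter h2
  set P : Set X := (⋃ q, D q) ∪ range (fun s => (α s : X)) with hP
  have hPc : IsClosed P :=
    (isClosed_iUnion_of_finite hDc).union
      (isCompact_range (continuous_subtype_val.comp α.continuous)).isClosed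
  have hPN : P ⊆ Ncut := by
    rintro y (hy | ⟨s, rfl⟩)
    · obtain ⟨q', hyq'⟩ := mem_iUnion.1 hy
      refine ⟨fun q hyq => ?_, fun hyF => hδA ?_⟩
      · by_cases hqq : q = q'
        · subst hqq; exact hDO q hyq'
        · have hyF : y ∈ (⋂ l, S l) :=
            spineHandlebody_succ_inter_subset S hqq ⟨hyq, hDH q' hyq'⟩
          exact hDO q (hδD q (by rw [← hDF q']; exact ⟨hyq', hyF⟩))
      · rw [← hDF q']; exact ⟨hyq', hyF⟩
    · exact ⟨fun q _ => hAO q (hαA s), fun _ => hαA s⟩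
  obtain ⟨ρ, hsupp, ⟨U1, -, hPU1, hρ1⟩, -⟩ := exists_cutoff_nhdsSet hPc hNo hPN
  have hU1N : U1 ⊆ Ncut := fun y hy =>
    hsupp (subset_tsupport ρ (by rw [mem_support, hρ1 y hy]; exact one_ne_zero))
  -- the two collapses on the handlebodies
  have hNq : ∀ q : Fin 2,
      IsOpen (Subtype.val ⁻¹' O q : Set ↥(Trisection.spineHandlebody S q.succ)) := fun q =>
    (hO q).preimage continuous_subtype_val
  have hKq : ∀ q : Fin 2, ContinuousOn (K q ∘ Subtype.val)
      (Subtype.val ⁻¹' O q : Set ↥(Trisection.spineHandlebody S q.succ)) := fun q =>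
    (hKcont q).comp continuous_subtype_val.continuousOn fun y hy => ⟨hy, y.2⟩
  have hKneq : ∀ q : Fin 2,
      ∀ y ∈ (Subtype.val ⁻¹' O q : Set ↥(Trisection.spineHandlebody S q.succ)),
      y ∉ (Subtype.val ⁻¹' D q : Set ↥(Trisection.spineHandlebody S q.succ)) →
      (K q ∘ Subtype.val) y ≠ 0 := fun q y hy hyD => hKne q y ⟨hy, y.2⟩ hyD
  have hρq : ∀ q : Fin 2,
      Continuous (ρ ∘ (Subtype.val : ↥(Trisection.spineHandlebody S q.succ) → X)) :=
    fun q => ρ.continuous.comp continuous_subtype_val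
  have hsuppq : ∀ q : Fin 2,
      tsupport (ρ ∘ (Subtype.val : ↥(Trisection.spineHandlebody S q.succ) → X)) ⊆
      Subtype.val ⁻¹' O q := fun q y hy =>
    (hsupp (tsupport_comp_subtype_val_subset ρ hy)).1 q y.2
  have hρPq : ∀ q : Fin 2,
      ∀ y ∈ (Subtype.val ⁻¹' D q : Set ↥(Trisection.spineHandlebody S q.succ)),
      (ρ ∘ Subtype.val) y ≠ 0 := fun q y hy => by
    show ρ y.1 ≠ 0
    rw [hρ1 _ (hPU1 (Or.inl (mem_iUnion.2 ⟨q, hy⟩)))]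
    exact one_ne_zero
  set Θ : ∀ q : Fin 2, C(↥((Trisection.spineHandlebody S q.succ)), AddCircle (1 : ℝ)) := fun q =>
    circleCollapseMap (hNq q) (hKq q) (hKneq q) (hρq q) (hsuppq q) (hρPq q) with hΘ
  -- the collapse `c` of `δ` in `(⋂ l, S l)`: the trace of `Θ_0`
  have hNF : IsOpen (Subtype.val ⁻¹' A : Set ↥(⋂ l, S l)) := hA.preimage continuous_subtype_val
  have hKF : ∀ q, ContinuousOn (K q ∘ Subtype.val) (Subtype.val ⁻¹' A : Set ↥(⋂ l, S l)) :=
    fun q => (hKcont q).comp continuous_subtype_val.continuousOn fun y hy => ⟨hAO q hy, hFH q y.2⟩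
  have hKneF : ∀ q, ∀ y ∈ (Subtype.val ⁻¹' A : Set ↥(⋂ l, S l)),
      y ∉ (Subtype.val ⁻¹' δ : Set ↥(⋂ l, S l)) → (K q ∘ Subtype.val) y ≠ 0 := fun q y hy hyδ =>
    hKne q y ⟨hAO q hy, hFH q y.2⟩ (hnotD q y y.2 hyδ)
  have hK0F : ∀ y ∈ (Subtype.val ⁻¹' δ : Set ↥(⋂ l, S l)), (K 0 ∘ Subtype.val) y = 0 := fun y hy =>
    hK0 0 y (hδD 0 hy)
  have hρF : Continuous (ρ ∘ (Subtype.val : ↥(⋂ l, S l) → X)) :=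
    ρ.continuous.comp continuous_subtype_val
  have hsuppF : tsupport (ρ ∘ (Subtype.val : ↥(⋂ l, S l) → X)) ⊆ Subtype.val ⁻¹' A := fun y hy =>
    (hsupp (tsupport_comp_subtype_val_subset ρ hy)).2 y.2
  have hρPF : ∀ y ∈ (Subtype.val ⁻¹' δ : Set ↥(⋂ l, S l)), (ρ ∘ Subtype.val) y ≠ 0 :=
      fun y hy => by
    show ρ y.1 ≠ 0
    rw [hρ1 _ (hPU1 (Or.inl (mem_iUnion.2 ⟨0, hδD 0 hy⟩)))]
    exact one_ne_zero
  set c : C(↥(⋂ l, S l), AddCircle (1 : ℝ)) :=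
    circleCollapseMap hNF (hKF 0) (hKneF 0) hρF hsuppF hρPF with hcdef
  -- the winding character of `c` at the base point `a`
  set w : FundamentalGroup ↥(⋂ l, S l) a →* Multiplicative ℤ :=
    (fundamentalGroupAddCircleEquiv one_ne_zero (c a)).toMonoidHom.comp (FundamentalGroup.map c a)
    with hw
  refine one_le_kZero_of_hom_spineHandlebody_succ h a.2 w (fun q => ?_) ?_
  · -- `w` vanishes on `ker (π₁ F → π₁ H_{q+1})`: the trace of `Θ_q` is `± c + [real]`
    set cq : C(↥(⋂ l, S l), AddCircle (1 : ℝ)) :=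
      (Θ q).comp (ContinuousMap.inclusion (hFH q)) with hcq
    have hker := ker_inclHomOfSubset_le_ker_windingHom (hFH q) a.2 (hFH q a.2) (Θ q) cq rfl
    have hcq_apply : ∀ y : ↥(⋂ l, S l), cq y =
        circleCollapse (K q ∘ (Subtype.val : ↥(⋂ l, S l) → X)) (ρ ∘ Subtype.val) y := fun y => rfl
    have hc_apply : ∀ y : ↥(⋂ l, S l), c y =
        circleCollapse (K 0 ∘ (Subtype.val : ↥(⋂ l, S l) → X)) (ρ ∘ Subtype.val) y := fun y => rfl
    have heq : ((fundamentalGroupAddCircleEquiv one_ne_zero (cq a)).toMonoidHom.comp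
        (FundamentalGroup.map cq a)).ker = w.ker := by
      rcases hcomp q with hq | hq
      · -- same sides on `(A ∩ (⋂ l, S l)) ∖ δ`
        have hsign : ∀ y ∈ (Subtype.val ⁻¹' A : Set ↥(⋂ l, S l)),
            y ∉ (Subtype.val ⁻¹' δ : Set ↥(⋂ l, S l)) →
            0 < (K q ∘ Subtype.val) y * (K 0 ∘ Subtype.val) y := fun y hy hyδ => by
          have hs := hq y ⟨⟨hy, y.2⟩, hyδ⟩
          obtain ⟨hv, -⟩ := hsd 0 y ⟨⟨hAO 0 hy, hFH 0 y.2⟩, hnotD 0 y y.2 hyδ⟩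
          have h1 : 0 < infDist (y : X) (D q) := hDpos q y (hnotD q y y.2 hyδ)
          have h2 : 0 < infDist (y : X) (D 0) := hDpos 0 y (hnotD 0 y y.2 hyδ)
          show 0 < sd q y * infDist (y : X) (D q) * (sd 0 y * infDist (y : X) (D 0))
          rw [hs]
          rcases hv with h0 | h0 <;> rw [h0] <;> nlinarith
        refine ker_windingHom_eq_of_eq_add_coe cq c
          (continuous_collapseDiff hNF (hKF q) (hKF 0) hsign hρF hsuppF hρPF) (fun y => ?_) a
        rw [hcq_apply, hc_apply]
        exact circleCollapse_eq_circleCollapse_add_coe _ _ _ y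
      · -- opposite sides on `(A ∩ (⋂ l, S l)) ∖ δ`: compare `K_q` with `-K_0`
        have hsign : ∀ y ∈ (Subtype.val ⁻¹' A : Set ↥(⋂ l, S l)),
            y ∉ (Subtype.val ⁻¹' δ : Set ↥(⋂ l, S l)) →
            0 < (K q ∘ Subtype.val) y * (fun z => -(K 0 ∘ Subtype.val) z) y := fun y hy hyδ => by
          have hs := hq y ⟨⟨hy, y.2⟩, hyδ⟩
          obtain ⟨hv, -⟩ := hsd 0 y ⟨⟨hAO 0 hy, hFH 0 y.2⟩, hnotD 0 y y.2 hyδ⟩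
          have h1 : 0 < infDist (y : X) (D q) := hDpos q y (hnotD q y y.2 hyδ)
          have h2 : 0 < infDist (y : X) (D 0) := hDpos 0 y (hnotD 0 y y.2 hyδ)
          show 0 < sd q y * infDist (y : X) (D q) * -(sd 0 y * infDist (y : X) (D 0))
          rw [hs]
          rcases hv with h0 | h0 <;> rw [h0] <;> nlinarith
        refine ker_windingHom_eq_of_eq_neg_add_coe cq c
          (continuous_collapseDiff hNF (hKF q) (hKF 0).neg hsign hρF hsuppF hρPF) (fun y => ?_) a
        rw [hcq_apply, hc_apply, ← circleCollapse_neg_left]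
        exact circleCollapse_eq_circleCollapse_add_coe _ _ _ y
    rw [← heq]
    exact hker
  · -- `w ≠ 1`: the crossing arc closed up by a path in `F ∖ δ` has winding number `+1`
    have h0lt : (0 : I) < s₀ := Subtype.coe_lt_coe.1 hs₀.1
    have hlt1 : s₀ < (1 : I) := Subtype.coe_lt_coe.1 hs₀.2
    have ha : (a : X) ∉ δ := by
      have := (hαneg 0 h0lt).1
      rwa [α.source] at this
    have hb : (b : X) ∉ δ := by
      have := (hαpos 1 hlt1).1
      rwa [α.target] at this
    -- the return path in `(⋂ l, S l) ∖ δ`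
    obtain ⟨β, hβ⟩ := h.exists_path_diff_of_isNonSeparating hc hns ⟨b.2, hb⟩ ⟨a.2, ha⟩
    have hVN : (Subtype.val ⁻¹' U1 : Set ↥(⋂ l, S l)) ⊆ Subtype.val ⁻¹' A := fun y hy =>
      (hU1N hy).2 y.2
    have hV1 : ∀ y ∈ (Subtype.val ⁻¹' U1 : Set ↥(⋂ l, S l)), (ρ ∘ Subtype.val) y = 1 := fun y hy =>
      hρ1 _ hy
    have hαV : ∀ s, α s ∈ (Subtype.val ⁻¹' U1 : Set ↥(⋂ l, S l)) := fun s =>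
      hPU1 (Or.inr ⟨s, rfl⟩)
    have hα0' : (K 0 ∘ Subtype.val) (α s₀) = 0 := hK0 0 _ (hδD 0 hα₀)
    have hαneg' : ∀ s, s < s₀ → (K 0 ∘ Subtype.val) (α s) < 0 := fun s hs => by
      obtain ⟨hsδ, hss⟩ := hαneg s hs
      have hpos := hDpos 0 (α s) (hnotD 0 _ (α s).2 hsδ)
      show sd 0 (α s) * infDist ((α s : X)) (D 0) < 0
      rw [hss]; linarith
    have hαpos' : ∀ s, s₀ < s → 0 < (K 0 ∘ Subtype.val) (α s) := fun s hs => by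
      obtain ⟨hsδ, hss⟩ := hαpos s hs
      have hpos := hDpos 0 (α s) (hnotD 0 _ (α s).2 hsδ)
      show 0 < sd 0 (α s) * infDist ((α s : X)) (D 0)
      rw [hss, one_mul]; exact hpos
    have hβ' : ∀ s, β s ∉ (Subtype.val ⁻¹' δ : Set ↥(⋂ l, S l)) := fun s => hβ s
    exact (windingHom_circleCollapse_ne_one_of_arc_of_path hNF (hKF 0) (hKneF 0) hK0F hρF hsuppF
      hρPF hVN hV1 α β hαV s₀ hα0' hαneg' hαpos' hβ').1

end Summit.SmoothPoincare4.SmoothPoincare4.Theorems.WeakReductionReduces.LoopDichotomy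

end
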